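import Mathlib
import HarnessLib
import Literature.Analysis.FluidPDE.VectorCalculus
import Summits.NavierStokesRegularity.NavierStokesRegularity.Theorems.UnthreadedRigidityDoorUnthreadedRigidityMixedPairSupports
import Summits.NavierStokesRegularity.NavierStokesRegularity.Theorems.UnthreadedRigidityDoorUnthreadedRigidityCoZonalSupports
import Summits.NavierStokesRegularity.NavierStokesRegularity.Theorems.UnthreadedRigidityDoorUnthreadedRigidityCoZonalOrderOne
import Summits.NavierStokesRegularity.NavierStokesRegularity.Theorems.UnthreadedRigidityDoorUnthreadedRigidityThreadingJetsSlice

/-!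
# Route `UnthreadedRigidityDoor`, item `UnthreadedRigidity` (W2, stmt-NavierStokesRegularity-27585) — LINE g11-2 «MIXED PAIR»:
# the support S-X `CoaxialPairAxisym` and the bridge O1 `OrderOneLawPair` BY NAME

Prover file (engine-1 g72, KEY-NS #205 (2)(c) slot; `--supports stmt-NavierStokesRegularity-27585 --as helper`) for LINE g11-2 «MIXED PAIR»
of planner ns-idea-6 g11/g12 (objects BY NAME in `…MixedPairDefs.lean`, sketch v1.4 fdd225c37c2e9dbd).
* the pair's angular parts: `gradient_dipoleHarmonic` (`∇⟪a,y⟫ = a`), `hasGradientAt_quadHarmonic` (`∇(yᵀQy) = 2Qy` for symmetric `Q`),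
  `quadHarmonic_eq_quadY` (`yᵀQy = Y_M`, `M i j = (Q e_j)_i`), `isSolidHarmonic_quadHarmonic` (degree two, via g10-2/g11-1's
  `isSolidHarmonic_quadY`), `pbr_dipoleHarmonic_quadHarmonic` (`{⟪a,·⟫, yᵀQy} = 2 det[y,a,Qy]`), `isZonalAbout_dipoleHarmonic`,
  `isZonalAbout_quadHarmonic_of_isCoaxial`, `pairShell_eq_twoShellL` (the pair IS the CO-ZONAL line's two-shell at degrees `(1,2)`, `rfl`);
* ★ `coaxialPairAxisym_holds : CoaxialPairAxisym` (S-X) — `IsCoaxial a Q` makes both harmonics zonal about `a`, so the pair is an instance of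
  Z⁺ `CoZonal.coZonalShellAxisym_holds`;
* ★ `orderOneLawPair_holds : OrderOneLawPair` (BRIDGE O1, stated M–L on the card; here L + M are both tree theorems): M = the jet dictionary
  `ThreadingJets.derivWithin_threadingFlux_Ici_eq_fluxJetOne` (ns-crc-p1 g8), L = O1₂ `CoZonal.twoShellSliceOrderOneIdentity_holds` (engine-1 g71)
  at `(l₁,l₂) = (1,2)`: `linkAmp 1 2 = 6H₂K₁ − 2H₁K₂` and `{⟪a,·⟫, yᵀQy} = 2det[y,a,Qy]` give `c₁ = −4(H₁K₂ − 3H₂K₁)·det[y,a,Qy]` verbatim.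
  The flux-regularity and pressure-decay hypotheses of O1 are not used (the one-sided first jet of a classical solution always exists).

HONEST LABEL: a support and a bridge of a RUNG line about SPECIAL two-shell data; `UnthreadedRigidity` (27585), W2 and NS regularity remain
OPEN; nothing here is a statement about Navier–Stokes regularity.  0 kit.
-/

-- the summit and its single sub-problem share the name (CONVENTIONS §1), as in every Theorems file
set_option linter.dupNamespace false

namespace Summit.NavierStokesRegularity.NavierStokesRegularity.Theorems.UnthreadedRigidity.MixedPair

open scoped Topology InnerProductSpace
open Filter Set
open Summit.NavierStokesRegularity.NavierStokesRegularity.Theorems.UnthreadedRigidity.ProfileHorn (E3 threadingFlux IsSliceAxisymmetric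
  quadY IsQuadForm)
open Summit.NavierStokesRegularity.NavierStokesRegularity.Theorems.UnthreadedRigidity.VirialHorn
open Summit.NavierStokesRegularity.NavierStokesRegularity.Theorems.UnthreadedRigidity.CoZonal (twoShellL linkAmp
  coZonalShellAxisym_holds twoShellSliceOrderOneIdentity_holds)
open Summit.NavierStokesRegularity.NavierStokesRegularity.Theorems.UnthreadedRigidity.ThreadingJets (fluxJetOne
  derivWithin_threadingFlux_Ici_eq_fluxJetOne)

/-! ## The angular parts of the pair: gradients, the bracket, zonality -/

section Angular

/-- the inner product in coordinates (private copy). -/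
private theorem real_inner_e3 (u v : E3) : ⟪u, v⟫_ℝ = u 0 * v 0 + u 1 * v 1 + u 2 * v 2 := by
  simp [PiLp.inner_apply, Fin.sum_univ_three, mul_comm]

/-- `det3` is linear in its third slot (scalars). -/
private theorem det3_smul_right (c : ℝ) (u v w : E3) : det3 u v (c • w) = c * det3 u v w := by
  simp only [det3, PiLp.smul_apply, smul_eq_mul]
  ring

/-- `det3` is alternating in its first two slots. -/
private theorem det3_swap_left (u v w : E3) : det3 u v w = -det3 v u w := by
  simp only [det3]
  ring

/-- `det[u, v, u] = 0`. -/
private theorem det3_self_right (u v : E3) : det3 u v u = 0 := by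
  simp only [det3]
  ring

/-- `∇⟪a, y⟫ = a`. -/
theorem hasGradientAt_dipoleHarmonic (a y : E3) : HasGradientAt (dipoleHarmonic a) a y := by
  rw [hasGradientAt_iff_hasFDerivAt]
  have h : HasFDerivAt (fun y : E3 => ⟪a, y⟫_ℝ) (innerSL ℝ a) y := (innerSL ℝ a).hasFDerivAt
  refine h.congr_fderiv ?_
  ext v
  simp [InnerProductSpace.toDual_apply_apply]

/-- `∇⟪a, ·⟫ ≡ a`. -/
theorem gradient_dipoleHarmonic (a : E3) : gradient (dipoleHarmonic a) = fun _ => a :=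
  funext fun y => (hasGradientAt_dipoleHarmonic a y).gradient

/-- `∇(yᵀQy) = 2Qy` for a symmetric `Q`. -/
theorem hasGradientAt_quadHarmonic {Q : E3 →L[ℝ] E3} (hQ : ∀ v w : E3, ⟪Q v, w⟫_ℝ = ⟪v, Q w⟫_ℝ) (y : E3) :
    HasGradientAt (quadHarmonic Q) ((2 : ℝ) • Q y) y := by
  rw [hasGradientAt_iff_hasFDerivAt]
  have h : HasFDerivAt (fun y : E3 => ⟪Q y, y⟫_ℝ) ((fderivInnerCLM ℝ (Q y, y)).comp ((Q : E3 →L[ℝ] E3).prod (ContinuousLinearMap.id ℝ E3))) y :=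
    Q.hasFDerivAt.inner ℝ (hasFDerivAt_id y)
  refine h.congr_fderiv ?_
  ext v
  simp only [ContinuousLinearMap.comp_apply, ContinuousLinearMap.prod_apply, ContinuousLinearMap.id_apply, fderivInnerCLM_apply,
    InnerProductSpace.toDual_apply_apply, real_inner_smul_left]
  have h1 := hQ v y
  have h2 := real_inner_comm (Q y) v
  linarith

/-- `∇(yᵀQy)` as a function, for symmetric `Q`. -/
theorem gradient_quadHarmonic {Q : E3 →L[ℝ] E3} (hQ : ∀ v w : E3, ⟪Q v, w⟫_ℝ = ⟪v, Q w⟫_ℝ) :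
    gradient (quadHarmonic Q) = fun y => (2 : ℝ) • Q y :=
  funext fun y => (hasGradientAt_quadHarmonic hQ y).gradient

/-- THE BRACKET OF THE PAIR: `{⟪a,·⟫, yᵀQy}(y) = det[y, a, 2Qy] = 2 det[y, a, Qy]` (symmetric `Q`). -/
theorem pbr_dipoleHarmonic_quadHarmonic {Q : E3 →L[ℝ] E3} (hQ : ∀ v w : E3, ⟪Q v, w⟫_ℝ = ⟪v, Q w⟫_ℝ) (a y : E3) :
    pbr (dipoleHarmonic a) (quadHarmonic Q) y = 2 * det3 y a (Q y) := by
  unfold pbr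
  rw [gradient_dipoleHarmonic, gradient_quadHarmonic hQ, det3_smul_right]

/-- the dipole harmonic is zonal about its own axis. -/
theorem isZonalAbout_dipoleHarmonic (a : E3) : IsZonalAbout a (dipoleHarmonic a) := by
  intro y
  rw [gradient_dipoleHarmonic]
  exact det3_self_right a y

/-- a COAXIAL quadrupole harmonic is zonal about the dipole axis: `det[a, y, 2Qy] = −2 det[y, a, Qy] = 0`. -/
theorem isZonalAbout_quadHarmonic_of_isCoaxial {a : E3} {Q : E3 →L[ℝ] E3} (hQ : ∀ v w : E3, ⟪Q v, w⟫_ℝ = ⟪v, Q w⟫_ℝ)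
    (hco : IsCoaxial a Q) : IsZonalAbout a (quadHarmonic Q) := by
  intro y
  rw [gradient_quadHarmonic hQ, det3_smul_right, det3_swap_left, hco y]
  ring

/-- a vector in coordinates over the standard basis `e`. -/
private theorem eq_sum_coord_smul_e (y : E3) : y = ∑ j : Fin 3, y j • e j := by
  ext i
  fin_cases i <;> simp [Fin.sum_univ_three, e]

/-- the coordinates of `Qy`: `(Qy)_i = Σ_j (Q e_j)_i y_j`. -/
private theorem apply_coord (Q : E3 →L[ℝ] E3) (y : E3) (i : Fin 3) : Q y i = ∑ j : Fin 3, (Q (e j)) i * y j := by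
  have h : Q y = ∑ j : Fin 3, y j • Q (e j) := by
    conv_lhs => rw [eq_sum_coord_smul_e y]
    simp only [map_sum, map_smul]
  rw [h]
  simp only [Fin.sum_univ_three, PiLp.add_apply, PiLp.smul_apply, smul_eq_mul]
  ring

/-- `yᵀQy` IS the quadratic form `Y_M` of the matrix `M i j = (Q e_j)_i` of `Q` in the standard basis. -/
theorem quadHarmonic_eq_quadY (Q : E3 →L[ℝ] E3) :
    quadHarmonic Q = quadY (Matrix.of fun i j : Fin 3 => (Q (e j)) i) := by
  funext y
  unfold quadHarmonic quadY
  rw [real_inner_e3, apply_coord Q y 0, apply_coord Q y 1, apply_coord Q y 2]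
  simp only [Matrix.of_apply, Fin.sum_univ_three]
  ring

/-- `⟪w, e_i⟫ = w_i` (private copy). -/
private theorem inner_e_right (w : E3) (i : Fin 3) : ⟪w, e i⟫_ℝ = w i := by
  rw [real_inner_e3]; fin_cases i <;> simp [e]

/-- for a traceless symmetric `Q` the matrix `M i j = (Q e_j)_i` is a quadratic form of `V₂` (symmetric, trace zero). -/
theorem isQuadForm_of_isTracelessSymmetric {Q : E3 →L[ℝ] E3} (hQ : IsTracelessSymmetric Q) :
    IsQuadForm (Matrix.of fun i j : Fin 3 => (Q (e j)) i) := by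
  obtain ⟨hsym, htr⟩ := hQ
  constructor
  · ext i j
    simp only [Matrix.transpose_apply, Matrix.of_apply]
    rw [← inner_e_right (Q (e i)) j, ← inner_e_right (Q (e j)) i, hsym, real_inner_comm]
  · rw [Matrix.trace_fin_three]
    simp only [Matrix.of_apply]
    simpa only [Fin.sum_univ_three, inner_e_right] using htr

/-- `yᵀQy` is a solid harmonic of degree two for traceless symmetric `Q`. -/
theorem isSolidHarmonic_quadHarmonic {Q : E3 →L[ℝ] E3} (hQ : IsTracelessSymmetric Q) : IsSolidHarmonic 2 (quadHarmonic Q) := by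
  rw [quadHarmonic_eq_quadY]
  exact isSolidHarmonic_quadY (isQuadForm_of_isTracelessSymmetric hQ)

/-- THE PAIR IS A TWO-SHELL at degrees `(1,2)` with angular parts `⟪a,·⟫` and `yᵀQy` (definitional). -/
theorem pairShell_eq_twoShellL (H₁ H₂ : ℝ → ℝ) (a : E3) (Q : E3 →L[ℝ] E3) (x₀ : E3) :
    pairShell H₁ H₂ a Q x₀ = twoShellL H₁ H₂ (dipoleHarmonic a) (quadHarmonic Q) x₀ := rfl

end Angular

/-! ## S-X and O1 by name -/

section ByName

/-- ★ **S-X `CoaxialPairAxisym` BY NAME**: a COAXIAL admissible pair (`det[y,a,Qy] ≡ 0`, i.e. `Q` zonal about the dipole axis `a`) is an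
axisymmetric slice about `x₀` — both angular parts are zonal about the common axis `a`, so the pair is an instance of Z⁺
`CoZonal.coZonalShellAxisym_holds` (one Householder frame for `a`, the infinitesimal identity summed). -/
theorem coaxialPairAxisym_holds : CoaxialPairAxisym := by
  intro H₁ H₂ a Q x₀ hadm hco
  obtain ⟨ha, hQ, hH₁, hH₂⟩ := hadm
  rw [pairShell_eq_twoShellL]
  exact coZonalShellAxisym_holds 1 2 H₁ H₂ (dipoleHarmonic a) (quadHarmonic Q) x₀ (isSolidHarmonic_dipoleHarmonic a)
    (isSolidHarmonic_quadHarmonic hQ) hH₁ hH₂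
    ⟨a, ha, isZonalAbout_dipoleHarmonic a, isZonalAbout_quadHarmonic_of_isCoaxial hQ.1 hco⟩

/-- ★ **BRIDGE O1 `OrderOneLawPair` BY NAME**: the one-sided first jet at `t₀` of the threading flux of a classical solution issuing from an
admissible pair is `c₁(x) = −4(H₁K₂ − 3H₂K₁)(|y|)·det[y, a, Qy]`, `y = x − x₀` (`Kᵢ = vortAmpL i Hᵢ`).  M-part: the one-sided jet is the
formal jet `fluxJetOne (u t₀) x₀ x` (`ThreadingJets.derivWithin_threadingFlux_Ici_eq_fluxJetOne`); L-part: O1₂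
`CoZonal.twoShellSliceOrderOneIdentity_holds` at degrees `(1,2)` — `Λ = linkAmp 1 2 H₁ H₂ = 6H₂K₁ − 2H₁K₂` and `{⟪a,·⟫,yᵀQy} = 2det[y,a,Qy]`;
at `x = x₀` both sides vanish. -/
theorem orderOneLawPair_holds : OrderOneLawPair := by
  intro t₀ T u p x₀ a Q H₁ H₂ hT hsol _hp _hcd hadm hu x
  obtain ⟨_, hQ, hH₁, hH₂⟩ := hadm
  rw [iteratedDerivWithin_one, derivWithin_threadingFlux_Ici_eq_fluxJetOne hsol hT, hu]
  by_cases hx : x = x₀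
  · subst hx
    simp [ThreadingJets.fluxJetOne, det3]
  · have hy : x - x₀ ≠ 0 := sub_ne_zero.mpr hx
    have key := twoShellSliceOrderOneIdentity_holds 1 2 H₁ H₂ (dipoleHarmonic a) (quadHarmonic Q) x₀ le_rfl (by norm_num)
      (isSolidHarmonic_dipoleHarmonic a) (isSolidHarmonic_quadHarmonic hQ) hH₁ hH₂ (x - x₀) hy
    rw [add_sub_cancel] at key
    rw [pairShell_eq_twoShellL, key, pbr_dipoleHarmonic_quadHarmonic hQ.1, linkAmp]
    push_cast
    ring

end ByName

end Summit.NavierStokesRegularity.NavierStokesRegularity.Theorems.UnthreadedRigidity.MixedPair
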